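import Summits.Langlands.Langlands.Theses.DyadicOddResidue
import Summits.Langlands.Langlands.Theorems.DyadicOddResidueOddPrimesRegularFMDictionary
import Literature.NumberTheory.Automorphic.FontaineMazurGL2OddPrime
import Literature.NumberTheory.GaloisRepresentations.OrdinaryTwistedDeterminant
import Literature.NumberTheory.GaloisRepresentations.CyclotomicCharacterFrobeniusProofs
import Literature.NumberTheory.Automorphic.AlgebraicityParityGL
import HarnessLib

/-!
# `DyadicOddResidue.OddPrimesRegularFM` (item stmt-Langlands-18743) from Fontaine–Mazur modularity
# up to a TATE twist: the newform → `L`-algebraic `π` conversion with the twist absorbed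

The route decl `Summit.Langlands.Langlands.Theses.DyadicOddResidue.OddPrimesRegularFM` is the
Fontaine–Mazur conjecture for `GL₂/ℚ` at every ODD prime `ℓ` in the regular case, in the summit's
automorphic `L`-normalisation: every continuous irreducible odd `ρ : Γ_ℚ → GL₂(ℚ̄_ℓ)`, unramified
almost everywhere and de Rham at `ℓ` (Fontaine's pinned datum) with distinct labelled Hodge–Tate
weights, is Satake–Frobenius compatible at almost all places with an `L`-algebraic cuspidal `π`
of `GL₂(𝔸_ℚ)`.  It is a PRINTED THEOREM (Pan 2022, Thm. 1.0.4, `p ≥ 5`; X. Zhang 2024,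
Thm. 1.0.2, `p = 3`; assembling Skinner–Wiles, Kisin, Hu–Tan, Paškūnas/Tung, Khare–Wintenberger),
vendored in the tree in the classical rendering "`ρ ⊗ χ` is attached to a newform `f`"
(`Literature.NumberTheory.Automorphic.XZhang2024_fontaineMazurGL2_oddPrime`).

This file proves the CONVERSION the item asks for — "newform up to twist ⟹ `L`-algebraic cuspidal
`π` with a.e. Satake matching, the twist absorbed into `π`" — for twists by an integral power of
the cyclotomic character (a Tate twist, which is what the printed proofs use to move the
Hodge–Tate weights `{a, b}` to `{0, k-1}`):

* `oddPrimesRegularFM_of_tateTwistModularity` — if for every odd `p` and every `ρ` as above some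
  Tate twist `ρ ⊗ ε^m` is attached (`IsGaloisRepOfNewform1`, away from `N p`) to a newform
  `f ∈ S_k(Γ₁(N))` along `ι_f : K_f → ℚ̄_p`, then `OddPrimesRegularFM`.  Proof: the conjugate
  newform of `f` along `τ = ι ∘ ι_f` yields an `L`-algebraic cuspidal `π₂` with Satake parameters
  `{β₁⁻¹, β₂⁻¹}` a.e., `τ(H_q(f)) = (X - β₁)(X - β₂)`
  (`exists_isLAlgebraic_hasSatakeParamAt_rootsInv_of_isNewform1`, companion file); the norm twist
  `π = π₂ ⊗ |det|^{-m}` is cuspidal, `L`-algebraic (integral twist) with Satake parameters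
  `q^m {β_j⁻¹}` (`HasSatakeParamAt.of_map_mulChar_detTwist_of_cpow`); on the Galois side
  `ρ = (ρ ⊗ ε^m) ⊗ ε^{-m}` is unramified at `q ∤ N p` (`ε` is, `cyclotomicPadicAlgCl_eq_one_of_mem_inertia`)
  with `charpoly ρ(Frob_q) = X² - q^{-m} ι_f(a_q) X + q^{-2m} ι_f(ε_f(q) q^{k-1})`
  (`ε(Frob_q) = q`, `charpoly_eq_of_charpoly_twist_eq`), which is
  `∏_j (X - ι⁻¹((q^m β_j⁻¹)⁻¹)) = arithFrobPolyOfSatake ι q 1 (q^m {β_j⁻¹})`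
  (`arithFrobPolyOfSatake_one_rootsInv_smul`).

The hypothesis is discharged from the printed theorem in the companion file
`DyadicOddResidueOddPrimesRegularFMOfXZhang` (named fact, Tate-twist rendering).  No statement of
the route file is altered; the route decl is concluded BY NAME.  Sorry-free; axioms
`propext`, `Classical.choice`, `Quot.sound`.
-/

noncomputable section

open scoped MatrixGroups Classical Polynomial NumberField
open NumberField IsDedekindDomain Filter Polynomial CongruenceSubgroup Field
open Literature.NumberTheory.Automorphic Literature.NumberTheory.EllipticCurves.ModularForms
  Literature.NumberTheory.GaloisRepresentations
open Summit.Langlands.Langlands.Cruxes.SerreKWAutomorphicGL2.AdelicNewformDatumDoubleTwist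

namespace Summit.Langlands.Langlands.Theorems

set_option linter.dupNamespace false -- project-wide option; `Summit.Langlands.Langlands` is the mandated namespace

open Rat.HeightOneSpectrum

/-! ## The cyclotomic character at the good places -/

section Cyclotomic

variable {K : Type} [Field K] [NumberField K] (p : ℕ) [Fact p.Prime]

/-- **`ε_p` is unramified away from `p`** (with `ℚ̄_p`-coefficients): for a finite place `v ∤ p`
of a number field, a prime `𝔓 ∣ v` of `\bar ℤ_K` and `σ ∈ I_𝔓`, `ε_p(σ) = 1` — inertia prime to
`p` fixes `μ_{p^∞}` (`smul_eq_self_of_mem_inertia_of_pow_prime_pow_eq_one`) and the cyclotomic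
character is `1` on such `σ` (`cyclotomicCharacter_eq_one_of_forall_pow_eq_one`).
Serre 1968, Ch. I §1.2 (Example). [cite: SerreAbelianLadic1968, Ch. I §1.2 (Example: the cyclotomic character)] -/
theorem cyclotomicPadicAlgCl_eq_one_of_mem_inertia {v : HeightOneSpectrum (𝓞 K)}
    (hv : (p : 𝓞 K) ∉ v.asIdeal) {𝔓 : Ideal (absIntegers (𝓞 K) K)} (h𝔓 : 𝔓 ∈ v.primesAbove)
    {σ : absoluteGaloisGroup K} (hσ : σ ∈ 𝔓.inertia (absoluteGaloisGroup K)) :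
    cyclotomicPadicAlgCl K p σ = 1 := by
  have hχ : GaloisRep.cyclotomicCharacter K p σ = 1 := by
    rw [GaloisRep.cyclotomicCharacter_apply]
    exact cyclotomicCharacter_eq_one_of_forall_pow_eq_one p _ fun n t ht =>
      smul_eq_self_of_mem_inertia_of_pow_prime_pow_eq_one hv h𝔓 hσ ht
  change Units.map (algebraMap ℤ_[p] (PadicAlgCl p) : ℤ_[p] →* PadicAlgCl p)
    (GaloisRep.cyclotomicCharacter K p σ) = 1
  rw [hχ, map_one]

/-- **`ε_p(Frob_v) = N v`** (with `ℚ̄_p`-coefficients): for `v ∤ p`, `𝔓 ∣ v` and an arithmetic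
Frobenius `σ` at `𝔓`, `ε_p(σ) = N v` in `ℚ̄_p` (`GaloisRep.cyclotomicCharacter_apply_of_isArithFrobAt`).
Serre 1968, Ch. I §1.2 (Example). [cite: SerreAbelianLadic1968, Ch. I §1.2 (Example: the cyclotomic character)] -/
theorem coe_cyclotomicPadicAlgCl_of_isArithFrobAt {v : HeightOneSpectrum (𝓞 K)}
    (hv : (p : 𝓞 K) ∉ v.asIdeal) {𝔓 : Ideal (absIntegers (𝓞 K) K)} (h𝔓 : 𝔓 ∈ v.primesAbove)
    {σ : absoluteGaloisGroup K} (hσ : IsArithFrobAt (𝓞 K) σ 𝔓) :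
    ((cyclotomicPadicAlgCl K p σ : (PadicAlgCl p)ˣ) : PadicAlgCl p) = (v.residueCard : PadicAlgCl p) := by
  rw [coe_cyclotomicPadicAlgCl_apply, GaloisRep.cyclotomicCharacter_apply_of_isArithFrobAt hv h𝔓 hσ]
  simp

end Cyclotomic

/-! ## Twisting back: ramification and Frobenius polynomials of `ρ` from those of `ρ ⊗ χ` -/

section TwistBack

variable {G : Type*} [Group G] [TopologicalSpace G] {A : Type*} [Field A] [TopologicalSpace A]
  [IsTopologicalRing A]

/-- **Characteristic polynomial of `ρ(g)` from that of `(ρ ⊗ χ)(g)`** in rank `2`: if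
`charpoly (ρ ⊗ χ)(g) = X² - a X + b` then `charpoly ρ(g) = X² - χ(g)⁻¹ a X + χ(g)⁻² b`
(`ρ(g) = χ(g)⁻¹ · (ρ ⊗ χ)(g)`; `charpoly` of a `2 × 2` matrix is `X² - tr X + det`). [folklore] -/
theorem charpoly_eq_of_charpoly_twist_eq (ρ : FramedRep G A 2) (χ : G →ₜ* Aˣ) (g : G) {a b : A}
    (h : FramedRep.charpoly (ρ.twist χ) g = X ^ 2 - C a * X + C b) :
    FramedRep.charpoly ρ g =
      X ^ 2 - C (((χ g : Aˣ) : A)⁻¹ * a) * X + C ((((χ g : Aˣ) : A)⁻¹) ^ 2 * b) := by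
  set M : Matrix (Fin 2) (Fin 2) A := ((ρ.twist χ g : GL (Fin 2) A) : Matrix (Fin 2) (Fin 2) A)
    with hMdef
  have hc : ((χ g : Aˣ) : A) ≠ 0 := Units.ne_zero _
  have hM : ((ρ g : GL (Fin 2) A) : Matrix (Fin 2) (Fin 2) A) = ((χ g : Aˣ) : A)⁻¹ • M := by
    rw [hMdef, FramedRep.coe_twist_apply, smul_smul, inv_mul_cancel₀ hc, one_smul]
  have hM2 : M.charpoly = X ^ 2 - C a * X + C b := h
  rw [Matrix.charpoly_fin_two] at hM2
  have htr : M.trace = a := by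
    have := congrArg (fun P : A[X] => P.coeff 1) hM2
    simpa using this
  have hdet : M.det = b := by
    have := congrArg (fun P : A[X] => P.coeff 0) hM2
    simpa using this
  change ((ρ g : GL (Fin 2) A) : Matrix (Fin 2) (Fin 2) A).charpoly = _
  rw [hM, Matrix.charpoly_fin_two, Matrix.trace_smul, Matrix.det_smul, Fintype.card_fin, htr, hdet,
    smul_eq_mul]

/-- If `ρ ⊗ χ` kills `g` and `χ(g) = 1` then `ρ` kills `g`. [folklore] -/
theorem apply_eq_one_of_twist_apply_eq_one {n : ℕ} (ρ : FramedRep G A n) (χ : G →ₜ* Aˣ) {g : G}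
    (hχ : χ g = 1) (h : ρ.twist χ g = 1) : ρ g = 1 := by
  rw [← FramedRep.twist_apply_of_eq_one ρ χ hχ]
  exact h

end TwistBack

/-! ## The `L`-normalised Frobenius polynomial of rescaled inverted roots -/

section FrobPoly

variable {p : ℕ} [Fact p.Prime]

/-- The complex roots of a monic quadratic `X² - a X + b`: `{β₁, β₂}` with `β₁ + β₂ = a`,
`β₁ β₂ = b` (`ℂ` is algebraically closed; Vieta). [folklore] -/
theorem exists_roots_eq_pair (a b : ℂ) :
    ∃ β₁ β₂ : ℂ, (X ^ 2 - C a * X + C b : ℂ[X]).roots = {β₁, β₂} ∧ β₁ + β₂ = a ∧ β₁ * β₂ = b := by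
  obtain ⟨β₁, β₂, h1, h2⟩ := exists_pair_add_eq_mul_eq a b
  refine ⟨β₁, β₂, ?_, h1, h2⟩
  have hP : (X ^ 2 - C a * X + C b : ℂ[X]) = (X - C β₁) * (X - C β₂) := by
    rw [← h1, ← h2]; simp only [map_add, map_mul]; ring
  rw [hP, Polynomial.roots_mul (mul_ne_zero (X_sub_C_ne_zero β₁) (X_sub_C_ne_zero β₂)),
    roots_X_sub_C, roots_X_sub_C]
  rfl

/-- **The `L`-normalised Frobenius polynomial of the rescaled inverted roots.**  For
`ι : ℚ̄_p ≃+* ℂ`, a complex quadratic `X² - a X + b = (X - β₁)(X - β₂)` and `w ∈ ℂ`,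
`arithFrobPolyOfSatake ι q 1 (w · {β₁⁻¹, β₂⁻¹}) = ∏_j (X - ι⁻¹(w⁻¹ β_j))
= X² - ι⁻¹(w⁻¹) ι⁻¹(a) X + ι⁻¹(w⁻¹)² ι⁻¹(b)` (Buzzard–Gee's `L`-normalisation
`α ↦ ∏ (X - ι⁻¹(α_j⁻¹))`). [cite: BuzzardGeeLMS2014, §2.1 and Rem. 3.2.5] -/
theorem arithFrobPolyOfSatake_one_rootsInv_smul (ι : PadicAlgCl p ≃+* ℂ) (q : ℕ) (a b w : ℂ) :
    arithFrobPolyOfSatake ι q 1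
        ((((X ^ 2 - C a * X + C b : ℂ[X]).roots.map (·⁻¹)).map (w * ·))) =
      X ^ 2 - C (ι.symm w⁻¹ * ι.symm a) * X + C ((ι.symm w⁻¹) ^ 2 * ι.symm b) := by
  obtain ⟨β₁, β₂, hr, h1, h2⟩ := exists_roots_eq_pair a b
  rw [arithFrobPolyOfSatake_one, hr]
  simp only [Multiset.insert_eq_cons, Multiset.map_cons, Multiset.map_singleton, Multiset.prod_cons,
    Multiset.prod_singleton, mul_inv, inv_inv, map_mul]
  rw [← h1, ← h2]
  simp only [map_add, map_mul, map_pow]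
  ring

end FrobPoly

/-! ## The conversion -/

/-- **`OddPrimesRegularFM` from Fontaine–Mazur modularity up to a Tate twist.**  Suppose that for
every odd prime `p` and every continuous `ρ : Γ_ℚ → GL₂(ℚ̄_p)` which is unramified almost
everywhere, irreducible, odd, and de Rham at `p` (Fontaine's pinned datum) with distinct labelled
Hodge–Tate weights, there are a continuous character `χ = ε_p^m` (`m ∈ ℤ`, `ε_p` the `p`-adic
cyclotomic character), a newform `f ∈ S_k(Γ₁(N))` and `ι_f : K_f → ℚ̄_p` with `ρ ⊗ χ` attached to
`f` away from `N p` (`IsGaloisRepOfNewform1`: unramified at `q ∤ N p` with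
`charpoly (ρ ⊗ χ)(Frob_q) = ι_f(X² - a_q X + ε_f(q) q^{k-1})`).  Then the route decl
`DyadicOddResidue.OddPrimesRegularFM` holds: for `ℓ ≠ 2`, `ρ`, `hcpt`, `ι : ℚ̄_ℓ ≃ ℂ`, the
`L`-algebraic cuspidal `π = π₂(f^τ) ⊗ |det|^{-m}` (`τ = ι ∘ ι_f`) is Satake–Frobenius compatible
with `ρ` at every `v = q ∤ N ℓ` outside the finite exceptional set of `π₂`: `π` has Satake
parameter `q^m {β₁⁻¹, β₂⁻¹}`, `ρ` is unramified at `v`, and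
`charpoly ρ(Frob_v) = X² - q^{-m} ι_f(a_q) X + q^{-2m} ι_f(ε_f(q) q^{k-1})
= arithFrobPolyOfSatake ι q 1 (q^m {β_j⁻¹})`.
[cite: BuzzardGeeLMS2014, Conj. 3.2.2 and Rem. 3.2.5] [cite: Gelbart1975, §3 Lemma 3.7 and Thm. 5.19]
[cite: SerreAbelianLadic1968, Ch. I §1.2 (Example: the cyclotomic character)] -/
theorem oddPrimesRegularFM_of_tateTwistModularity
    (H : ∀ (p : ℕ) [Fact p.Prime], p ≠ 2 →
      ∀ (ρ : FramedGaloisRep ℚ (PadicAlgCl p) 2),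
        (∀ᶠ v : HeightOneSpectrum (𝓞 ℚ) in cofinite, ρ.IsUnramifiedAt v) →
        ρ.toGaloisRep.IsIrreducible → ρ.IsOdd →
        (∀ (v : HeightOneSpectrum (𝓞 ℚ)) (hv : ((p : ℕ) : 𝓞 ℚ) ∈ v.asIdeal),
          (Literature.NumberTheory.PAdicHodge.fontainePstAdicCompletion v p hv).IsDeRhamFramed
              (ρ.toLocal v) ∧
            ∀ τ : v.adicCompletion ℚ →+* PadicAlgCl p, Continuous τ →
              (ρ.labelledHodgeTateWeightsAt v
                (Literature.NumberTheory.PAdicHodge.fontainePstAdicCompletion v p hv).algebra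
                (Literature.NumberTheory.PAdicHodge.fontainePstAdicCompletion v p hv).𝔅 τ).Nodup) →
        ∃ (χ : absoluteGaloisGroup ℚ →ₜ* (PadicAlgCl p)ˣ) (m : ℤ),
          (∀ σ, χ σ = cyclotomicPadicAlgCl ℚ p σ ^ m) ∧
          ∃ (N : ℕ) (_ : NeZero N) (k : ℤ) (f : CuspForm (Gamma1 N) k)
            (ιf : coeffCharField f →+* PadicAlgCl p),
            IsNewform1 f ∧ IsGaloisRepOfNewform1 f ιf {q | q ∣ N * p} (FramedRep.twist ρ χ)) :
    Summit.Langlands.Langlands.Theses.DyadicOddResidue.OddPrimesRegularFM := by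
  intro ℓ _ hℓ ρ hirr hodd hunr hdR hcpt ι
  have hℓp : ℓ.Prime := Fact.out
  obtain ⟨χ, m, hχ, N, _, k, f, ιf, hf, hρ'⟩ := H ℓ hℓ ρ hunr hirr hodd hdR
  -- the automorphic side: `π₂ = π(f^τ)` (L-normalised) and its norm twist `π = π₂ ⊗ |det|^{-m}`
  set τ : coeffCharField f →+* ℂ := (ι : PadicAlgCl ℓ →+* ℂ).comp ιf with hτdef
  obtain ⟨π₂, ⟨T, hT, hTL⟩, hsat₂⟩ :=
    exists_isLAlgebraic_hasSatakeParamAt_rootsInv_of_isNewform1 hf τ hcpt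
  obtain ⟨η, π, hη, hW, hW', hTπ⟩ :=
    CuspidalAutomorphicRepData.exists_twist_hasInfinityType π₂ (((-m : ℤ) : ℝ)) hT
  refine ⟨π, ⟨_, hTπ, ?_⟩, ?_⟩
  · rw [Complex.ofReal_intCast]
    exact (InfinityType.isLAlgebraic_twist_intCast_iff T (-m)).2 hTL
  have hgood := eventually_not_dvd (n := N * ℓ) (mul_ne_zero (NeZero.ne N) hℓp.ne_zero)
  filter_upwards [hsat₂, hgood] with v hv₂ hvNℓ
  -- notation at the good place `v`: `q = p_v`, `q ∤ N ℓ`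
  have hq : ((Rat.HeightOneSpectrum.primesEquiv v : Nat.Primes) : ℕ) = natGenerator v := rfl
  have hℓv : (ℓ : 𝓞 ℚ) ∉ v.asIdeal := fun h =>
    hvNℓ (hq ▸ Dvd.dvd.mul_left ((Rat.natCast_mem_asIdeal_iff v).1 h) N)
  obtain ⟨hunr', hfrob'⟩ := hρ' v hvNℓ
  have hsatπ := AutomorphicRepData.HasSatakeParamAt.of_map_mulChar_detTwist_of_cpow hη hW hW' hv₂
  refine ⟨_, hsatπ, ?_, ?_⟩
  · -- `ρ` is unramified at `v`: `ρ ⊗ ε^m` is, and `ε` is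
    intro 𝔓 h𝔓 σ hσ
    refine apply_eq_one_of_twist_apply_eq_one ρ χ ?_ (hunr' 𝔓 h𝔓 σ hσ)
    rw [hχ, cyclotomicPadicAlgCl_eq_one_of_mem_inertia ℓ hℓv h𝔓 hσ, one_zpow]
  · -- the Frobenius polynomial
    intro 𝔓 h𝔓 σ hσ
    have h2 := hfrob' 𝔓 h𝔓 σ hσ
    -- the Hecke polynomial of `f` at `q`, along `ι_f` and along `τ = ι ∘ ι_f`
    set aK : coeffCharField f := ⟨(UpperHalfPlane.qExpansion 1 ⇑f).coeff (natGenerator v),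
      cuspCoeff_mem_coeffCharField f _⟩ with haK
    set bK : coeffCharField f := ⟨(nebentypus f ((natGenerator v : ℕ) : ZMod N) : ℂ) *
        ((natGenerator v : ℕ) : ℂ) ^ (k - 1), nebentypus_mul_zpow_mem_coeffCharField f _⟩ with hbK
    have hH : heckePolynomial f (natGenerator v) = X ^ 2 - C aK * X + C bK := rfl
    rw [hq, hH, Polynomial.map_add, Polynomial.map_sub, Polynomial.map_mul, Polynomial.map_pow,
      map_X, map_C, map_C] at h2
    have hρσ := charpoly_eq_of_charpoly_twist_eq ρ χ σ h2
    -- `χ(σ) = ε(σ)^m = q^m`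
    have hc : ((χ σ : (PadicAlgCl ℓ)ˣ) : PadicAlgCl ℓ) = ((natGenerator v : ℕ) : PadicAlgCl ℓ) ^ m := by
      rw [hχ, Units.val_zpow_eq_zpow_val, coe_cyclotomicPadicAlgCl_of_isArithFrobAt ℓ hℓv h𝔓 hσ,
        Rat.residueCard_eq_natGenerator]
    rw [hρσ, hq, hH, Polynomial.map_add, Polynomial.map_sub, Polynomial.map_mul, Polynomial.map_pow,
      map_X, map_C, map_C, arithFrobPolyOfSatake_one_rootsInv_smul]
    -- compare coefficients: `ι⁻¹(w⁻¹) = q^{-m} = χ(σ)⁻¹`, `ι⁻¹ ∘ τ = ι_f`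
    have hw : ι.symm ((v.residueCard : ℂ) ^ (-((((-m : ℤ) : ℝ)) : ℂ)))⁻¹ =
        (((natGenerator v : ℕ) : PadicAlgCl ℓ) ^ m)⁻¹ := by
      rw [Rat.residueCard_eq_natGenerator, Complex.ofReal_intCast, ← Int.cast_neg, neg_neg,
        Complex.cpow_intCast, map_inv₀, map_zpow₀, map_natCast]
    have hτ : ∀ x : coeffCharField f, ι.symm (τ x) = ιf x := fun x => by
      rw [hτdef, RingHom.comp_apply]
      exact ι.symm_apply_apply _
    rw [hw, hτ, hτ, hc]

end Summit.Langlands.Langlands.Theorems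

end
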